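/-
Copyright: rh-split cell, typer-2 gen 9, 2026-08-28.  LADDER-RH bookkeeping (route WeilDualDensity, assembly
item); nothing in this file bears on the truth of RH.
-/
import Summits.RiemannHypothesis.RiemannHypothesis.Theses.WeilDualDensity
import HarnessLib

/-!
# [24994] `WeilDualDensity.Assembly` — the deciding composition of route WeilDualDensity (PROVED)

Item stmt-RiemannHypothesis-24994 (assembly, rank 1): `AcBelowRung → AcDualWitnessAtOne → Target`, where
`Target = X1 ∧ X2`, `X1 : (∀ b > 0, an absolutely continuous dual witness ρ ≥ 0 on [−b, b]) ↔ RH` and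
`X2 = AcDualWitnessAtOne` (the instance at the banked rung `b = 1`).  Pure bookkeeping over the tree:
* `X2` is the second hypothesis verbatim;
* `X1 (⟹)`: a dual witness on `[−b, b]` gives `WeilPositivityOn b` (SOUNDNESS: `Re W(g ⋆ g̃) = ∫ ‖ĝ(½+it)‖² ρ(t) dt ≥ 0`,
  an integral of a nonnegative integrand, `MeasureTheory.integral_nonneg`), and Weil's criterion
  `Literature.NumberTheory.LFunctions.riemannHypothesis_iff_forall_weilPositivityOn` (tree) with
  `Summit.RiemannHypothesis_iff` gives RH;
* `X1 (⟸)`: RH gives `WeilPositivityOn (b + 1)` by the same criterion, and `AcBelowRung (b+1) b` an a.c. witness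
  on `[−b, b]`.
Proof = planner rh-idea-3 g5's `assembly_holds` (pub/ideators/rh-idea-3/g5/Sketch.lean 3bcdf8d74e47d453, farm rc 0)
re-targeted at the ROUTE declarations; keyed by rh-split-lead RULING #492.  The two cruxes [24992]/[24993] stay
open; no summit is proved by this line.

HONEST LABEL: SPLITTING SEARCH over kernel-typed RH-EQUIVALENCES; a splitting `A ∧ B ⟹ RH` is CONDITIONAL
bookkeeping unless `A` and `B` are both proved; nothing here bears on the truth of RH.
-/

noncomputable section

-- D-0017: `Summit.RiemannHypothesis.RiemannHypothesis.…` duplicates the namespace BY DESIGN (single-problem summit).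
set_option linter.dupNamespace false

namespace Summit.RiemannHypothesis.RiemannHypothesis.Theorems.WeilDualDensityAssembly

open MeasureTheory
open Summit.RiemannHypothesis.RiemannHypothesis.Theses.WeilDualDensity

/-- **[24994] assembly, proved**: `AcBelowRung → AcDualWitnessAtOne → Target` for route WeilDualDensity —
soundness of absolutely continuous dual witnesses (`∫` of a nonnegative integrand) + Weil's criterion
`riemannHypothesis_iff_forall_weilPositivityOn` for `X1`, the second hypothesis verbatim for `X2`. -/
theorem assembly_proof : Summit.RiemannHypothesis.RiemannHypothesis.Theses.WeilDualDensity.Assembly := by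
  unfold Assembly
  intro hK1 hK2
  refine ⟨⟨fun h => ?_, fun hRH b hb => ?_⟩, hK2⟩
  · rw [Summit.RiemannHypothesis_iff,
      Literature.NumberTheory.LFunctions.riemannHypothesis_iff_forall_weilPositivityOn]
    intro a ha
    obtain ⟨ρ, _, hρ0, hρ⟩ := h a ha
    intro g hg hs
    obtain ⟨_, heq⟩ := hρ g hg hs
    rw [heq]
    exact integral_nonneg fun t => mul_nonneg (by positivity) (hρ0 t)
  · have hW : Literature.NumberTheory.LFunctions.WeilPositivityOn (b + 1) :=
      (Literature.NumberTheory.LFunctions.riemannHypothesis_iff_forall_weilPositivityOn.mp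
        (Summit.RiemannHypothesis_iff.mp hRH)) (b + 1) (by linarith)
    exact hK1 (b + 1) b hb (by linarith) hW

end Summit.RiemannHypothesis.RiemannHypothesis.Theorems.WeilDualDensityAssembly

end
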